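import Literature.MathematicalPhysics.QuantumFieldTheory.Balaban1983to89.B8Lemma1NonAbelian

/-!
# `Balaban1983to89.B14Ineq313` — CMP 119 (3.13) p. 267: "Applying Lemma 1 [14] we obtain
# `|V^{(k)} − V^{(k)}_{□′}| < (4dL)²(1+β₀)B₃ε_k` on `□′^~`", TYPED in printed form and PROVED in the exact-axial
# block-pair model as the literal application of the tree's kernel proof of Lemma 1 of [14]
# (`B8Lemma1NonAbelian.lemma1_printedBound`, `α₀ = 4L²(1+β₀)B₃ε_k`, `α₁ = 0`): `4d²α₀ = (4dL)²(1+β₀)B₃ε_k`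

statement-level skeleton of published theorems with citation tags; proofs where landed; nothing here is a claim
about the Yang–Mills mass gap.

CITATION HEADER (lean-in-tree rule).  Source: T. Bałaban, *Convergent renormalization expansions for lattice gauge
theories*, Commun. Math. Phys. **119**, 243–285 (1988), doi:10.1007/bf01217741 [Balaban1988Convergent] (cell paper
B14; held `paper:balaban1988-cmp119-convergent-renormalization`, journal page = PDF page + 242; the passage below was
read on the x2 render of PDF p. 25 = p. 267).  "[14]" = entry [14] of the reference list of [I] = CMP 109, i.e.
T. Bałaban, *Spaces of regular gauge field configurations on a lattice and gauge fixing conditions*, Commun. Math.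
Phys. **99**, 75–102 (1985) [Balaban1985RegularSpaces] (cell paper B8), Lemma 1 p. 79: typed `B8.Lemma1Printed`,
PROVED on the `ℤ^d` block-pair carriers in `B8Lemma1NonAbelian`.  Mega-formalization `lit-balaban`, unit
`lit-balaban-r11` (CMP 119), SKELETON row `B14.Claim@267` (the (3.13) clause, so far "absent: claim by reference to
B8 Lemma 1"); the sibling (3.14) is `B14Sect3.ineq314_of` (triangle inequality, landed earlier by the cell).

THE PRINTED TEXT (p. 267, verbatim): *"Consider a cube □′ ⊂ Ω_{k+1}. The restrictions on the fields V_k, V_{k+1}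
on Ω~_{k+1}, and Theorem 1 from [16] imply, that U_{k+1} satisfies the following regularity condition:
|U_{k+1}(∂p) − 1| < 2B₃L²(1+β₀)ε_k(L⁻¹η)²  for  p ⊂ □′~. (3.12)
On this cube the configuration U_{k+1,□′} satisfies the regularity condition as above, only with the coefficient 1
in front of ε_{k+1}. By the definition of these configurations, and the constraints on V_k, we have
M^{k+1}(U_{k+1}) = V_{k+1} = M^{k+1}(U_{k+1,□′}) on □′~. Applying Lemma 1 [14] we obtain
|V^{(k)} − V^{(k)}_{□′}| < (4dL)²(1+β₀)B₃ε_k  on  □′~, (3.13)"*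
— here `V^{(k)} = M^k(U_{k+1})` ((3.10) p. 266) and `V^{(k)}_{□′} = M^k(U_{k+1,□′})` ((3.3) p. 265) are fields
on the unit lattice `T^{(k)}_1` of the `k`-th step, and Lemma 1 of [14] is applied "for k = 1 and L arbitrary"
with the `L`-blocks of the `(k+1)`-st averaging: `V₀ := V^{(k)}_{□′}`, `V′V₀ := V^{(k)}`.

ARITHMETIC OF THE APPLICATION (why the printed constant is Lemma 1's): Lemma 1 of [14] concludes
`|V′ − 1| < 4d²α₀ + α₁` from plaquettes `α₀L⁻²`-close to `1` ((1.7) of [14] for k = 1), agreeing axial trees and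
`α₁`-close block averages.  Here the block averages AGREE (`M^{k+1}(U_{k+1}) = M^{k+1}(U_{k+1,□′})`, so `α₁ = 0`)
and the printed right side is `(4dL)²(1+β₀)B₃ε_k = 4d²·α₀` with `α₀ = 4L²(1+β₀)B₃ε_k`, i.e. plaquette smallness
`α₀L⁻² = 4(1+β₀)B₃ε_k` for BOTH fields on the unit `k`-lattice (twice the `2B₃(1+β₀)ε_k` that (3.12) gives per
`η`-plaquette after rescaling by `(L^kη)² = 1`… — the factor the print absorbs from the averaging, Prop. 1 of [12];
we do not re-derive (3.12) ⇒ this smallness, it is the HYPOTHESIS `plaqV`, `plaqVbox` below, stated with exactly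
the constant that makes Lemma 1 output the printed (3.13)).

WHAT IS TYPED, AND THE MODEL (declared deviations, referee columns F6/F7):
* `Hyp313 L V Vbox y κ a` — on ONE block pair `B(c₋) ∪ B(c₊)` of `(k+1)`-blocks (side `L`) of the unit
  `k`-lattice `ℤ^d`: `V = V^{(k)}`, `Vbox = V^{(k)}_{□′}` are `U1 𝔸`-valued, their plaquettes are `a`-close to `1`,
  (D1) their axial trees AGREE on both blocks (print: both configurations come with the axial gauge conditions on
  `B(y)`, `y ∈ Γ_{k+1}` of (3.10)/(3.3); exact agreement is the (1.24)-hypothesis of Lemma 1 of [14] as the print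
  applies it), and their block-bond averages ((42) of [12], `bavg`) agree (printed: `M^{k+1}(U_{k+1}) = V_{k+1} =
  M^{k+1}(U_{k+1,□′})`).
* (D2) "on `□′^~`" is typed per block pair (the bound is bondwise and local, [14] p. 80), as in `B14Claim247`.
* (D3) smallness: Lemma 1 of [14] is "for α₀, α₁ small"; the tree's proof has the explicit threshold
  `α₀ ≤ 1/(6(d+1))`, i.e. here `4L²(1+β₀)B₃ε_k ≤ 1/(6(d+1))` — an explicit hypothesis of `Ineq313Printed` (in B14
  all statements are for `g_k`, hence `ε_k`, sufficiently small, p. 246).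
* The printed left side `|V^{(k)} − V^{(k)}_{□′}|` is typed bondwise as `‖V_b·Vbox_b⁻¹ − 1‖` (Lemma 1's `|V′ − 1|`,
  `V′ = V^{(k)}(V^{(k)}_{□′})⁻¹`); for unitary bond variables the two agree, `‖V − W‖ = ‖VW⁻¹ − 1‖`
  (`norm_sub_eq_norm_mul_inv_sub_one`, C⋆-case).
`Ineq313Printed d 𝔸` is a closed `Prop` per `(d, 𝔸)` and `Ineq313Printed_holds` proves it (net new unproved facts 0).
-/

open scoped BigOperators
open NormedSpace Finset

namespace Literature.MathematicalPhysics.QuantumFieldTheory.Balaban1983to89.B14.Ineq313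

open B7Prop1Explicit MatrixLog B8Lemma1NonAbelian
open B8Lemma1Lattice (InBlock)

-- `Site` alone could resolve to the torus sites of `Setup.lean` through a parent namespace; re-export the `ℤ^d`
-- sites `Fin d → ℤ` of `B7Prop1Explicit` (the convention of `B8Lemma1NonAbelian`).
export B7Prop1Explicit (Site)

variable {d : ℕ}

section Model

variable {𝔸 : Type*} [NormedRing 𝔸] [NormOneClass 𝔸] [NormedAlgebra ℂ 𝔸] [CompleteSpace 𝔸]

/-- **The hypotheses under which p. 267 applies Lemma 1 of [14]**, on one pair of `(k+1)`-blocks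
`B(c₋) ∪ B(c₊)`, `c = ⟨y, y + Le_κ⟩`, of the unit `k`-lattice: `V = V^{(k)} = M^k(U_{k+1})` and
`Vbox = V^{(k)}_{□′} = M^k(U_{k+1,□′})` are `U1 𝔸`-valued; their plaquette variables are `a`-close to `1` on the
pair ((3.12) and its `U_{k+1,□′}`-twin, after the `k`-fold averaging); their axial trees agree on both blocks
(model (D1)); their block-bond averages agree: `M^{k+1}(U_{k+1}) = V_{k+1} = M^{k+1}(U_{k+1,□′})` (printed).
[cite: Balaban1988Convergent, (3.12)–(3.13) p.267] -/
structure Hyp313 (L : ℕ) (V Vbox : Site d → Fin d → 𝔸ˣ) (y : Site d) (κ : Fin d) (a : ℝ) : Prop where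
  memV : ∀ x μ, V x μ ∈ U1 𝔸
  memVbox : ∀ x μ, Vbox x μ ∈ U1 𝔸
  plaqV : B8Lemma1NonAbelian.PlaqSmall V y (y + pairTop L κ) a
  plaqVbox : B8Lemma1NonAbelian.PlaqSmall Vbox y (y + pairTop L κ) a
  axial : ∀ r : Fin d → Fin L, axialFn V y (y + boxVec L r) = axialFn Vbox y (y + boxVec L r)
  axial₁ : ∀ r : Fin d → Fin L, axialFn V (y + (L : ℤ) • e κ) (y + (L : ℤ) • e κ + boxVec L r)
    = axialFn Vbox (y + (L : ℤ) • e κ) (y + (L : ℤ) • e κ + boxVec L r)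
  avg : bavg L V y κ = bavg L Vbox y κ

/-- `Hyp313 … a` is the hypothesis block `Hyp` of the tree's Lemma 1 of [14] with plaquette constant `a` and
average discrepancy `α₁ = 0` (`V₀ := Vbox`, `V′V₀ := V`). [cite: Balaban1988Convergent, (3.13) p.267] -/
theorem Hyp313.toHyp {L : ℕ} {V Vbox : Site d → Fin d → 𝔸ˣ} {y : Site d} {κ : Fin d} {a : ℝ}
    (H : Hyp313 L V Vbox y κ a) : Hyp L V Vbox y κ a 0 where
  memU := H.memV
  memV₀ := H.memVbox
  plaqU := H.plaqV
  plaqV₀ := H.plaqVbox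
  axial := H.axial
  axial₁ := H.axial₁
  avg := by rw [H.avg, sub_self, norm_zero]

/-- **(3.13) on a block pair, as the literal application of Lemma 1 of [14]** (`lemma1_printedBound` with
`α₀ = 4L²(1+β₀)B₃ε_k`, `α₁ = 0`): if the plaquettes of `V^{(k)}` and `V^{(k)}_{□′}` are
`4(1+β₀)B₃ε_k = α₀L⁻²`-close to `1` on the pair, the axial trees and the block averages agree, and
`0 < α₀ ≤ 1/(6(d+1))`, then every bond `b` of the pair has `‖V_b Vbox_b⁻¹ − 1‖ < (4dL)²(1+β₀)B₃ε_k`.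
[cite: Balaban1988Convergent, (3.13) p.267] -/
theorem ineq313_blockPair {L : ℕ} (hL : 1 ≤ L) {V Vbox : Site d → Fin d → 𝔸ˣ} {y : Site d} {κ : Fin d}
    {β₀ B₃ εk : ℝ} (H : Hyp313 L V Vbox y κ (4 * (1 + β₀) * B₃ * εk))
    (hpos : 0 < (1 + β₀) * B₃ * εk) (hsmall : 4 * (L : ℝ) ^ 2 * ((1 + β₀) * B₃ * εk) ≤ 1 / (6 * ((d : ℝ) + 1)))
    (x : Site d) (ν : Fin d) (hx : InPair L y κ x) (hxν : InPair L y κ (x + e ν)) :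
    ‖((pert V Vbox x ν : 𝔸ˣ) : 𝔸) - 1‖ < (4 * (d : ℝ) * L) ^ 2 * (1 + β₀) * B₃ * εk := by
  have h1 : (1 : ℝ) ≤ L := by exact_mod_cast hL
  have hL2 : (0 : ℝ) < (L : ℝ) ^ 2 := by positivity
  set α₀ : ℝ := 4 * (L : ℝ) ^ 2 * ((1 + β₀) * B₃ * εk) with hα₀
  have hα₀pos : 0 < α₀ := by positivity
  have ha : α₀ / (L : ℝ) ^ 2 = 4 * (1 + β₀) * B₃ * εk := by
    rw [hα₀]; field_simp
  have H' : Hyp L V Vbox y κ (α₀ / (L : ℝ) ^ 2) 0 := by rw [ha]; exact H.toHyp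
  have hb := lemma1_printedBound hL H' hα₀pos hsmall le_rfl (by norm_num) x ν hx hxν
  have hc : 4 * (d : ℝ) ^ 2 * α₀ + 0 = (4 * (d : ℝ) * L) ^ 2 * (1 + β₀) * B₃ * εk := by
    rw [hα₀]; ring
  rwa [hc] at hb

end Model

section Unitary

variable {𝔸 : Type*} [CStarAlgebra 𝔸]

/-- For unitary bond variables the printed left side `|V − W|` of (3.13) IS Lemma 1's `|VW⁻¹ − 1|`:
`‖V − W‖ = ‖VW* − 1‖` (`W` unitary, C⋆-norm). [cite: Balaban1988Convergent, (3.13) p.267] -/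
theorem norm_sub_eq_norm_mul_star_sub_one (V : 𝔸) {W : 𝔸} (hW : W ∈ unitary 𝔸) :
    ‖V - W‖ = ‖V * star W - 1‖ := by
  have h : (V * star W - 1) * W = V - W := by
    rw [sub_mul, one_mul, mul_assoc, Unitary.star_mul_self_of_mem hW, mul_one]
  rw [← h, CStarRing.norm_mul_mem_unitary _ hW]

end Unitary

section Printed

/-- **B14 (3.13) p. 267 (verbatim): *"Applying Lemma 1 [14] we obtain |V^{(k)} − V^{(k)}_{□′}| <
(4dL)²(1+β₀)B₃ε_k on □′~"*** — typed in printed form over the block-pair model `Hyp313` (deviations (D1)–(D3) of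
the module docstring): for every block side `L ≥ 1`, all constants `β₀, B₃, ε_k` with `(1+β₀)B₃ε_k > 0` and the
smallness `4L²(1+β₀)B₃ε_k ≤ 1/(6(d+1))` of Lemma 1 of [14], every pair `(V^{(k)}, V^{(k)}_{□′})` satisfying the
hypotheses with plaquette constant `4(1+β₀)B₃ε_k`, and every bond `b` of the block pair:
`‖V^{(k)}_b (V^{(k)}_{□′,b})⁻¹ − 1‖ < (4dL)²(1+β₀)B₃ε_k`. [cite: Balaban1988Convergent, (3.13) p.267] -/
def Ineq313Printed (d : ℕ) (𝔸 : Type*) [NormedRing 𝔸] [NormOneClass 𝔸] [NormedAlgebra ℂ 𝔸]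
    [CompleteSpace 𝔸] : Prop :=
  ∀ L : ℕ, 1 ≤ L → ∀ β₀ B₃ εk : ℝ, 0 < (1 + β₀) * B₃ * εk →
    4 * (L : ℝ) ^ 2 * ((1 + β₀) * B₃ * εk) ≤ 1 / (6 * ((d : ℝ) + 1)) →
    ∀ (V Vbox : Site d → Fin d → 𝔸ˣ) (y : Site d) (κ : Fin d), Hyp313 L V Vbox y κ (4 * (1 + β₀) * B₃ * εk) →
      ∀ (x : Site d) (ν : Fin d), InPair L y κ x → InPair L y κ (x + e ν) →
        ‖((pert V Vbox x ν : 𝔸ˣ) : 𝔸) - 1‖ < (4 * (d : ℝ) * L) ^ 2 * (1 + β₀) * B₃ * εk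

/-- **`Ineq313Printed` HOLDS** (exact-axial block-pair model), by `ineq313_blockPair` = the tree's kernel proof of
Lemma 1 of [14] at `α₀ = 4L²(1+β₀)B₃ε_k`, `α₁ = 0`. [cite: Balaban1988Convergent, (3.13) p.267] -/
theorem Ineq313Printed_holds (d : ℕ) (𝔸 : Type*) [NormedRing 𝔸] [NormOneClass 𝔸] [NormedAlgebra ℂ 𝔸]
    [CompleteSpace 𝔸] : Ineq313Printed d 𝔸 :=
  fun _L hL _β₀ _B₃ _εk hpos hsmall _V _Vbox _y _κ H x ν hx hxν =>
    ineq313_blockPair hL H hpos hsmall x ν hx hxν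

end Printed

end Literature.MathematicalPhysics.QuantumFieldTheory.Balaban1983to89.B14.Ineq313
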